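import Summits.Ventures.CertifiedArithmetic.LowPrec.GemmDyadicStep
import Summits.Ventures.CertifiedArithmetic.LowPrec.Monotone

/-!
# The `bfloat16` bridge on dyadic grids below `2^64` grid units, and `rne8` is monotone

HONEST FRAMING (venture CertifiedArithmetic / cell `pub-lowprec`, seat gemm, gen 8): certified error
envelopes and provably optimal rounding/accumulation schemes for low-precision formats under stated
cost models; every table by two implementations; no hardware or vendor claims.

Purpose: `GemmGridRounding.lean` / `GemmDyadicStep.lean` proved `fl_bf16(K/2^g) = rne8 K / 2^g` for
`|K| < 2^32` (enough for the FP6 alphabets).  The E4M3·E4M3 products of `gemm.tex` §Regimes live on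
the grid `2^-18` with partial sums up to `2^26`, i.e. `2^44` grid units; this file re-proves the
bridge for `|K| < 2^64` directly from `rne8`'s binade (`Nat.log2`), without the fuel-bounded search of
`rneQuarter`: `toRat_roundNE_BFloat16_rne8`, the step/gain/deficit dictionary `flStep_dyadic64`,
`gainOf_dyadic64`, `deficitOf_dyadic64`, the monotonicity of `rne8` below `2^64`
(`rne8_mono`, from `toRat_roundNE_mono`), and the product grid of E4M3 (`toRat_mul_toRat_E4M3`,
grid `2^-18`).  Nothing here is specific to gemm.
-/

namespace Literature.ComputerArithmetic.FloatingPoint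

namespace MiniFloat

open Format

/-- The binade of `n ≥ 256` found by `Nat.log2`: `2^(7+k) ≤ n < 2^(7+k+1)` with `k = log₂ n - 7`.
[folklore] -/
theorem log2_binade {n : ℕ} (h1 : 256 ≤ n) :
    2 ^ (7 + (Nat.log2 n - 7)) ≤ n ∧ n < 2 ^ (7 + (Nat.log2 n - 7) + 1) := by
  have hn : n ≠ 0 := by omega
  have hA : 2 ^ Nat.log2 n ≤ n := Nat.log2_self_le hn
  have hB : n < 2 ^ (Nat.log2 n + 1) := Nat.lt_log2_self
  have h8 : 8 ≤ Nat.log2 n := by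
    by_contra hlt
    have := Nat.pow_le_pow_right (by norm_num : 0 < 2) (show Nat.log2 n + 1 ≤ 8 by omega)
    omega
  rw [show 7 + (Nat.log2 n - 7) = Nat.log2 n by omega]
  exact ⟨hA, hB⟩

/-- THE BRIDGE on the grid `2^-g`, `g ≤ 133`, below `2^64` grid units:
`fl_bf16(K / 2^g) = rne8 K / 2^g`. [folklore; closed form `Format.rneGrid_of_pattern`] -/
theorem toRat_roundNE_BFloat16_rne8 {g : ℕ} (hg : g ≤ 133) (K : ℤ) (hK : K.natAbs < 2 ^ 64) :
    (roundNE Format.BFloat16 ((K : ℚ) / 2 ^ g)).toRat = (rne8 K : ℚ) / 2 ^ g := by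
  have h2g : (0 : ℚ) < 2 ^ g := by positivity
  have habs : |(K : ℚ) / 2 ^ g| = (K.natAbs : ℚ) / 2 ^ g := by
    rw [abs_div, abs_of_pos h2g, Nat.cast_natAbs, Int.cast_abs]
  have hsgn : (K : ℚ) / 2 ^ g < 0 ↔ K < 0 := by
    rw [div_lt_iff₀ h2g, zero_mul]; norm_cast
  by_cases hn : K.natAbs < 256
  · -- exact branch
    rw [toRat_roundNE_of_exists (exists_toRat_eq_BFloat16_dyadic hg hn)]
    unfold rne8 rne8Mag
    rw [if_pos hn]
    have : (if K < 0 then -((K.natAbs : ℕ) : ℤ) else ((K.natAbs : ℕ) : ℤ)) = K := by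
      split_ifs with h <;> omega
    rw [this]
  · -- pattern branch
    set k := Nat.log2 K.natAbs - 7 with hk
    set d := 133 - g with hd
    obtain ⟨hlo, hhi⟩ := log2_binade (not_lt.mp hn)
    have hq2 : Format.BFloat16.quantum = 1 / 2 ^ 133 := BFloat16_maxRat.2
    have h133 : (2 : ℚ) ^ 133 = 2 ^ d * 2 ^ g := by rw [← pow_add, hd, Nat.sub_add_cancel hg]
    have hx : |(K : ℚ) / 2 ^ g|
        = (K.natAbs : ℚ) * 2 ^ (d + k) / 2 ^ k * Format.BFloat16.quantum := by
      rw [habs, hq2, h133, pow_add]; field_simp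
    have hmax : |(K : ℚ) / 2 ^ g| ≤ Format.BFloat16.maxRat := by
      rw [habs, BFloat16_maxRat.1]
      have hlt : ((K.natAbs : ℕ) : ℚ) < 2 ^ 64 := by exact_mod_cast hK
      have h1 : (1 : ℚ) ≤ 2 ^ g := one_le_pow₀ (by norm_num)
      calc ((K.natAbs : ℕ) : ℚ) / 2 ^ g ≤ (K.natAbs : ℕ) := div_le_self (by positivity) h1
        _ ≤ (2 ^ 8 - 1) * 2 ^ 120 := by norm_num at hlt ⊢; linarith
    have hlo' : 2 ^ (Format.BFloat16.manBits + k) ≤ K.natAbs := by rw [BFloat16_manBits]; exact hlo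
    have hhi' : K.natAbs < 2 ^ (Format.BFloat16.manBits + k + 1) := by
      rw [BFloat16_manBits]; exact hhi
    have hgrid := Format.rneGrid_of_pattern hlo' hhi' (pattern_le_maxScaled hx hmax)
    rw [rneInt_natCast_div_two_pow, Int.cast_natCast] at hgrid
    rw [toRat_roundNE, scaledInput_of_pattern hx]
    unfold rne8 rne8Mag
    rw [if_neg hn, ← hk]
    simp only [hsgn]
    split_ifs with hneg
    · rw [neg_mul, hgrid, hq2, h133]; push_cast; rw [pow_add]; field_simp
    · rw [hgrid, hq2, h133]; push_cast; rw [pow_add]; field_simp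

/-- A grid value `(rne8 K)/2^g` is a `bfloat16` value (it is a rounding). [folklore] -/
theorem exists_toRat_eq_rne8_dyadic {g : ℕ} (hg : g ≤ 133) (K : ℤ) (hK : K.natAbs < 2 ^ 64) :
    ∃ y : MiniFloat Format.BFloat16, y.toRat = (rne8 K : ℚ) / 2 ^ g :=
  ⟨_, toRat_roundNE_BFloat16_rne8 hg K hK⟩

/-- `rne8` IS MONOTONE below `2^64` — it is `fl_bf16` on the integers. [folklore] -/
theorem rne8_mono {a b : ℤ} (ha : a.natAbs < 2 ^ 64) (hb : b.natAbs < 2 ^ 64) (hab : a ≤ b) :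
    rne8 a ≤ rne8 b := by
  have h1 := toRat_roundNE_BFloat16_rne8 (g := 0) (by norm_num) a ha
  have h2 := toRat_roundNE_BFloat16_rne8 (g := 0) (by norm_num) b hb
  have hab' : (a : ℚ) / 2 ^ 0 ≤ (b : ℚ) / 2 ^ 0 := by
    rw [pow_zero, div_one, div_one]; exact_mod_cast hab
  have hm := toRat_roundNE_mono (φ := Format.BFloat16) hab'
  rw [h1, h2, pow_zero, div_one, div_one] at hm
  exact_mod_cast hm

/-! ### One step, gain and deficit in grid units (below `2^64`) -/

/-- `fl_bf16(V/2^g + Q/2^g) = rne8(V + Q)/2^g`. [cell; the bridge] -/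
theorem flStep_dyadic64 {g : ℕ} (hg : g ≤ 133) {V Q : ℤ} (h : (V + Q).natAbs < 2 ^ 64) :
    flStep Format.BFloat16 ((V : ℚ) / 2 ^ g) ((Q : ℚ) / 2 ^ g) = (rne8 (V + Q) : ℚ) / 2 ^ g := by
  unfold flStep
  rw [show (V : ℚ) / 2 ^ g + (Q : ℚ) / 2 ^ g = ((V + Q : ℤ) : ℚ) / 2 ^ g by push_cast; ring]
  exact toRat_roundNE_BFloat16_rne8 hg (V + Q) h

/-- The gain in grid units. [cell] -/
theorem gainOf_dyadic64 {g : ℕ} (hg : g ≤ 133) {V Q : ℤ} (h : (V + Q).natAbs < 2 ^ 64) :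
    gainOf Format.BFloat16 ((V : ℚ) / 2 ^ g) ((Q : ℚ) / 2 ^ g)
      = ((rne8 (V + Q) - V - Q : ℤ) : ℚ) / 2 ^ g := by
  unfold gainOf; rw [flStep_dyadic64 hg h]; push_cast; ring

/-- The deficit in grid units. [cell] -/
theorem deficitOf_dyadic64 {g : ℕ} (hg : g ≤ 133) {V Q : ℤ} (h : (V + Q).natAbs < 2 ^ 64) :
    deficitOf Format.BFloat16 ((V : ℚ) / 2 ^ g) ((Q : ℚ) / 2 ^ g)
      = (((Q.natAbs : ℤ) - (rne8 (V + Q) - V - Q) : ℤ) : ℚ) / 2 ^ g := by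
  unfold deficitOf
  rw [gainOf_dyadic64 hg h, abs_div, abs_of_pos (by positivity : (0 : ℚ) < 2 ^ g), ← Int.cast_abs,
    ← Int.natCast_natAbs]
  push_cast; ring

/-! ### Products of E4M3 data are integers on the grid `2^-18` -/

/-- `qexp(E4M3) = -9`: E4M3·E4M3 products live on the grid `2^-18`. [cite: MicikeviciusEtAl2022, Table 1] -/
theorem E4M3_qexp_add : Format.E4M3.qexp + Format.E4M3.qexp = -18 := by decide

/-- An E4M3·E4M3 product in grid units: `a · b = (toInt a · toInt b) / 2^18`. [folklore] -/
theorem toRat_mul_toRat_E4M3 (a b : MiniFloat Format.E4M3) :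
    a.toRat * b.toRat = ((a.toInt * b.toInt : ℤ) : ℚ) / 2 ^ 18 := by
  rw [toRat_mul_toRat, E4M3_qexp_add, zpow_neg, div_eq_mul_inv]; norm_cast

end MiniFloat

end Literature.ComputerArithmetic.FloatingPoint
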